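import Literature.RingTheory.FormalGroups.FormalOModuleBudDescent
import Literature.RingTheory.FormalGroups.FormalOModuleBudExtension
import Mathlib.RingTheory.Localization.FractionRing
import Mathlib.RingTheory.MvPolynomial.Tower
import HarnessLib

/-!
# Buds of formal `𝒪`-module laws, XII: every bud extends, and buds lift along surjections
# ([Lazard 1955] Thm. II–III («tout bourgeon est prolongeable»); [Drinfeld 1974] §1 Prop. 1.4)

Topic `Literature/RingTheory/FormalGroups`; namespace `Literature.RingTheory.FormalGroups`.  Two `Prop`-valued definitions
(the induction predicates `BudExt`, `BudLift`) + fully proved theorems; no named fact, no instance, no notation, no `sorry`.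
Cell `hodgecm-mathlib`, P6 «MOD programme», sub-line P6d (power-series layer for `stub_L4B3cO`).

`𝒪` is a DVR with finite residue field of characteristic `p`.  By simultaneous induction on `k ≥ 1`:
* `BudExt 𝒪 k` — every `k`-bud of formal `𝒪`-module laws over every `𝒪`-algebra is congruent `mod deg k+1` to a `(k+1)`-bud
  (Lazard's «prolongement des bourgeons», with `𝒪`-action);
* `BudLift 𝒪 k` — along a surjection `π : B′ ↠ B`, a `k`-bud over `B′` lying over a `(k+1)`-bud over `B` `mod deg k+1` can be
  corrected into a `(k+1)`-bud over `B′` lying over it `mod deg k+2`.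
`BudLift k ⇐ BudExt k` (★ `exists_isDrinfeldCocycle_of_sub`, ★ `IsDrinfeldCocycle.exists_lift`, ★ `add_cocycle`), and
`BudExt k ⇐ BudLift j (j < k)`: lift the bud to the polynomial ring `P = 𝒪[X_b : b ∈ B] ↠ B`, extend over `P ⊗ K`
(★ `exists_extend_of_units`), descend to `P` (★ `exists_extend_of_injective`), push down to `B`.
Main results: `budExt`, `budLift` (all `k ≥ 1`, all universes).
-/

noncomputable section

namespace Literature.RingTheory.FormalGroups

open MvPowerSeries (HasSubst subst X order coeff)
open Finset Finsupp

universe u v v' w w'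

variable (𝒪 : Type u) [CommRing 𝒪]

/-! ## §1 The induction predicates -/

/-- **`BudExt 𝒪 k`**: every `k`-bud over every `𝒪`-algebra (in universe `w`) is congruent `mod deg k+1` to a `(k+1)`-bud.
[cite: Lazard1955, Thm. III] -/
def BudExt (k : ℕ) : Prop :=
  ∀ (B : Type w) [CommRing B] [Algebra 𝒪 B] (f : MvPowerSeries (Fin 2) B) (r : 𝒪 → PowerSeries B),
    IsOModuleBud 𝒪 k f r → ∃ (F : MvPowerSeries (Fin 2) B) (ρ : 𝒪 → PowerSeries B), IsOModuleBud 𝒪 (k + 1) F ρ ∧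
      ((k + 1 : ℕ) : ℕ∞) ≤ (F - f).order ∧ ∀ a, ((k + 1 : ℕ) : ℕ∞) ≤ MvPowerSeries.order (ρ a - r a)

/-- **`BudLift 𝒪 k`**: along a surjective `𝒪`-algebra map `π : B′ → B`, a `k`-bud `(F, ρ)` over `B′` lying `mod deg k+1` over a
`(k+1)`-bud `(G, σ)` over `B` is congruent `mod deg k+1` to a `(k+1)`-bud over `B′` lying over `(G, σ)` `mod deg k+2`.
[cite: Lazard1955, Thm. II–III] [cite: Drinfeld1974, §1 Prop. 1.4] -/
def BudLift (k : ℕ) : Prop :=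
  ∀ (B' : Type w') (B : Type w) [CommRing B'] [Algebra 𝒪 B'] [CommRing B] [Algebra 𝒪 B] (π : B' →ₐ[𝒪] B),
    Function.Surjective π →
    ∀ (G : MvPowerSeries (Fin 2) B) (σ : 𝒪 → PowerSeries B), IsOModuleBud 𝒪 (k + 1) G σ →
    ∀ (F : MvPowerSeries (Fin 2) B') (ρ : 𝒪 → PowerSeries B'), IsOModuleBud 𝒪 k F ρ →
      ((k + 1 : ℕ) : ℕ∞) ≤ (MvPowerSeries.map π.toRingHom F - G).order →
      (∀ a, ((k + 1 : ℕ) : ℕ∞) ≤ MvPowerSeries.order (PowerSeries.map π.toRingHom (ρ a) - σ a)) →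
      ∃ (F' : MvPowerSeries (Fin 2) B') (ρ' : 𝒪 → PowerSeries B'), IsOModuleBud 𝒪 (k + 1) F' ρ' ∧
        ((k + 1 : ℕ) : ℕ∞) ≤ (F' - F).order ∧ (∀ a, ((k + 1 : ℕ) : ℕ∞) ≤ MvPowerSeries.order (ρ' a - ρ a)) ∧
        ((k + 2 : ℕ) : ℕ∞) ≤ (MvPowerSeries.map π.toRingHom F' - G).order ∧
        ∀ a, ((k + 2 : ℕ) : ℕ∞) ≤ MvPowerSeries.order (PowerSeries.map π.toRingHom (ρ' a) - σ a)

variable {𝒪}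

/-! ## §2 `BudLift k` from `BudExt k` -/

/-- Base change of Lazard's polynomial series. [cite: Lazard1955, §II Lemme 3] -/
theorem map_lazardSeries {B B' : Type*} [CommRing B] [CommRing B'] (f : B' →+* B) (m : ℕ) :
    MvPowerSeries.map f (lazardSeries B' m) = lazardSeries B m := by
  simp [lazardSeries, map_sum, MvPowerSeries.map_X]

/-- The additive `1`-bud over `B′` lies over any bud over `B` `mod deg 2`. [folklore] -/
private theorem additive_lies_over {B : Type w} {B' : Type w'} [CommRing B] [Algebra 𝒪 B] [CommRing B'] [Algebra 𝒪 B']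
    (π : B' →ₐ[𝒪] B) {k : ℕ} {f : MvPowerSeries (Fin 2) B} {r : 𝒪 → PowerSeries B} (h : IsOModuleBud 𝒪 k f r) :
    ((2 : ℕ) : ℕ∞) ≤ (MvPowerSeries.map π.toRingHom (X 0 + X 1 : MvPowerSeries (Fin 2) B') - f).order ∧
      ∀ a, ((2 : ℕ) : ℕ∞) ≤ MvPowerSeries.order
        (PowerSeries.map π.toRingHom (algebraMap 𝒪 B' a • (PowerSeries.X : PowerSeries B')) - r a) := by
  constructor
  · rw [map_add, MvPowerSeries.map_X, MvPowerSeries.map_X, show (X 0 + X 1 : MvPowerSeries (Fin 2) B) - f = -(f - X 0 - X 1)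
      by ring, MvPowerSeries.order_neg]
    exact h.two_le_order_F
  · intro a
    have e : PowerSeries.map π.toRingHom (algebraMap 𝒪 B' a • (PowerSeries.X : PowerSeries B')) - r a =
        -(r a - algebraMap 𝒪 B a • PowerSeries.X) := by
      rw [PowerSeries.smul_eq_C_mul, map_mul, PowerSeries.map_C, PowerSeries.map_X, ← PowerSeries.smul_eq_C_mul]
      change π (algebraMap 𝒪 B' a) • _ - _ = _
      rw [π.commutes]; ring
    rw [e, MvPowerSeries.order_neg]; exact h.two_le_order_ρ a

variable [IsDomain 𝒪] [IsDiscreteValuationRing 𝒪] [Finite (IsLocalRing.ResidueField 𝒪)]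
  (p : ℕ) [Fact p.Prime] [CharP (IsLocalRing.ResidueField 𝒪) p]

include p in
/-- Drinfeld cocycles lift along surjections between `𝒪`-modules in possibly different universes
(★ `IsDrinfeldCocycle.exists_generator` + ★ `isDrinfeldCocycle_of_div`). [cite: Drinfeld1974, §1 Prop. 1.4] -/
theorem IsDrinfeldCocycle.exists_lift' {m : ℕ} (hm : 2 ≤ m) {N : Type v} {N' : Type v'} [AddCommGroup N] [Module 𝒪 N]
    [AddCommGroup N'] [Module 𝒪 N'] (g : N' →ₗ[𝒪] N) (hg : Function.Surjective g) {c : N} {δ : 𝒪 → N}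
    (h : IsDrinfeldCocycle m c δ) :
    ∃ (c' : N') (δ' : 𝒪 → N'), IsDrinfeldCocycle m c' δ' ∧ g c' = c ∧ ∀ a, g (δ' a) = δ a := by
  obtain ⟨w, qν, q, hw, hqν, hq, hall⟩ := IsDrinfeldCocycle.exists_generator (𝒪 := 𝒪) p hm
  obtain ⟨d, hc, hδ⟩ := hall N c δ h
  obtain ⟨d', hd'⟩ := hg d
  exact ⟨qν • d', fun a => q a • d', isDrinfeldCocycle_of_div (by omega) hw hqν hq d',
    by rw [map_smul, hd', hc], fun a => by rw [map_smul, hd', hδ]⟩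

include p in
/-- **`BudLift k` from `BudExt k`** (`k ≥ 1`): extend, compare with the target (a Drinfeld cocycle over `B`,
★ `exists_isDrinfeldCocycle_of_sub`), lift the cocycle along `π` (★ `IsDrinfeldCocycle.exists_lift`) and add it
(★ `add_cocycle`). [cite: Drinfeld1974, §1 Prop. 1.4] -/
theorem budLift_of_budExt {k : ℕ} (hk : 1 ≤ k) (hext : BudExt.{u, w'} 𝒪 k) : BudLift.{u, w, w'} 𝒪 k := by
  intro B' B _ _ _ _ π hπ G σ hG F ρ hF hFG hρσ
  have hm : 2 ≤ k + 1 := by omega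
  obtain ⟨F₀, ρ₀, h₀, hF₀, hρ₀⟩ := hext B' F ρ hF
  -- push the extension down and compare with the target
  have h₀B := h₀.map π
  have hGF : ((k + 1 : ℕ) : ℕ∞) ≤ (G - MvPowerSeries.map π.toRingHom F₀).order := by
    have e : G - MvPowerSeries.map π.toRingHom F₀ = -(MvPowerSeries.map π.toRingHom F - G) -
        MvPowerSeries.map π.toRingHom (F₀ - F) := by rw [map_sub]; ring
    rw [e]
    exact natCast_le_order_sub (by rwa [MvPowerSeries.order_neg]) (hF₀.trans (MvPowerSeries.le_order_map _))
  have hσρ : ∀ a, ((k + 1 : ℕ) : ℕ∞) ≤ MvPowerSeries.order (σ a - PowerSeries.map π.toRingHom (ρ₀ a)) := fun a => by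
    have e : σ a - PowerSeries.map π.toRingHom (ρ₀ a) = -(PowerSeries.map π.toRingHom (ρ a) - σ a) -
        PowerSeries.map π.toRingHom (ρ₀ a - ρ a) := by rw [map_sub]; ring
    rw [e]
    refine natCast_le_order_sub (by rw [MvPowerSeries.order_neg]; exact hρσ a) ((hρ₀ a).trans ?_)
    exact MvPowerSeries.le_order_map (φ := ρ₀ a - ρ a) π.toRingHom
  obtain ⟨c, hc, hdr⟩ := IsOModuleBud.exists_isDrinfeldCocycle_of_sub hm h₀B hG hGF hσρ
  -- lift the cocycle along `π`
  obtain ⟨c', δ', hcδ', hc', hδ'⟩ := IsDrinfeldCocycle.exists_lift' p hm π.toLinearMap hπ hdr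
  have h₁ := h₀.add_cocycle hm hcδ'
  have hLord : ∀ (x : B), ((k + 1 : ℕ) : ℕ∞) ≤ (x • lazardSeries B (k + 1)).order :=
    fun x => le_trans (le_order_lazardSeries (k + 1)) MvPowerSeries.le_order_smul
  have hLord' : ∀ (x : B'), ((k + 1 : ℕ) : ℕ∞) ≤ (x • lazardSeries B' (k + 1)).order :=
    fun x => le_trans (le_order_lazardSeries (k + 1)) MvPowerSeries.le_order_smul
  have hXord : ∀ (x : B), ((k + 1 : ℕ) : ℕ∞) ≤ MvPowerSeries.order (x • (PowerSeries.X : PowerSeries B) ^ (k + 1)) := fun x =>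
    le_trans (natCast_le_order_pow (by change PowerSeries.constantCoeff PowerSeries.X = 0; simp) _) MvPowerSeries.le_order_smul
  have hXord' : ∀ (x : B'), ((k + 1 : ℕ) : ℕ∞) ≤ MvPowerSeries.order (x • (PowerSeries.X : PowerSeries B') ^ (k + 1)) :=
    fun x => le_trans (natCast_le_order_pow (by change PowerSeries.constantCoeff PowerSeries.X = 0; simp) _)
      MvPowerSeries.le_order_smul
  refine ⟨F₀ + c' • lazardSeries B' (k + 1), fun a => ρ₀ a + δ' a • PowerSeries.X ^ (k + 1), h₁, ?_, fun a => ?_, ?_, fun a => ?_⟩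
  · rw [show F₀ + c' • lazardSeries B' (k + 1) - F = (F₀ - F) + c' • lazardSeries B' (k + 1) by ring]
    exact natCast_le_order_add hF₀ (hLord' c')
  · rw [show ρ₀ a + δ' a • PowerSeries.X ^ (k + 1) - ρ a = (ρ₀ a - ρ a) + δ' a • PowerSeries.X ^ (k + 1) by ring]
    exact natCast_le_order_add (hρ₀ a) (hXord' (δ' a))
  · -- `π_*(F₀ + c'·C) − G = (π_*F₀ − G) + c·C`: order `≥ k+1`, degree-`(k+1)` coefficients `−c_j c + c_j c = 0`
    have e : MvPowerSeries.map π.toRingHom (F₀ + c' • lazardSeries B' (k + 1)) - G =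
        (MvPowerSeries.map π.toRingHom F₀ - G) + c • lazardSeries B (k + 1) := by
      rw [map_add, MvPowerSeries.smul_eq_C_mul, map_mul, MvPowerSeries.map_C, map_lazardSeries, ← MvPowerSeries.smul_eq_C_mul]
      change _ + π c' • _ - G = _
      rw [show π c' = c from hc']; ring
    rw [e]
    refine natCast_succ_le_order (natCast_le_order_add (natCast_le_order_sub_comm hGF) (hLord c)) fun d hd => ?_
    have hd2 : d = single 0 (d 0) + single 1 (k + 1 - d 0) ∧ d 0 ≤ k + 1 := by
      rw [degree_eq_sum, Fin.sum_univ_two] at hd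
      refine ⟨Finsupp.ext fun i => ?_, by omega⟩
      fin_cases i
      · simp
      · simp; omega
    rw [hd2.1, ← degCoeff_of_le _ hd2.2, degCoeff_add, degCoeff_smul_lazardSeries,
      show MvPowerSeries.map π.toRingHom F₀ - G = -(G - MvPowerSeries.map π.toRingHom F₀) by ring,
      show degCoeff (k + 1) (-(G - MvPowerSeries.map π.toRingHom F₀)) (d 0) = -degCoeff (k + 1) (G - MvPowerSeries.map π.toRingHom F₀) (d 0)
        by rw [← neg_one_smul B, degCoeff_smul]; ring, hc, neg_add_cancel]
  · have e : PowerSeries.map π.toRingHom (ρ₀ a + δ' a • PowerSeries.X ^ (k + 1)) - σ a =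
        (PowerSeries.map π.toRingHom (ρ₀ a) - σ a) + PowerSeries.coeff (k + 1) (σ a - PowerSeries.map π.toRingHom (ρ₀ a)) •
          (PowerSeries.X : PowerSeries B) ^ (k + 1) := by
      rw [map_add]
      change _ + PowerSeries.map π.toRingHom (δ' a • PowerSeries.X ^ (k + 1)) - σ a = _
      rw [PowerSeries.smul_eq_C_mul, map_mul, PowerSeries.map_C, map_pow, PowerSeries.map_X, ← PowerSeries.smul_eq_C_mul]
      change _ + π (δ' a) • _ - σ a = _
      rw [show π (δ' a) = PowerSeries.coeff (k + 1) (σ a - PowerSeries.map π.toRingHom (ρ₀ a)) from hδ' a]; ring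
    rw [e]
    refine natCast_succ_le_order (natCast_le_order_add (natCast_le_order_sub_comm (hσρ a)) (hXord _)) fun d hd => ?_
    have hd1 : d = single () (k + 1) := by
      rw [degree_eq_sum, Fintype.sum_unique] at hd
      exact Finsupp.ext fun u => by obtain ⟨⟩ := u; simpa using hd
    rw [hd1, ← PowerSeries.coeff_def (s := single () (k + 1)) (n := k + 1) (by simp), map_add, map_smul,
      PowerSeries.coeff_X_pow_self, smul_eq_mul, mul_one, map_sub, map_sub]
    ring

/-! ## §3 `BudExt k` from `BudLift j`, `j < k` -/

section Ext

variable {B : Type w} [CommRing B] [Algebra 𝒪 B]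

include p in
/-- **`BudExt k` from `BudLift j` (`1 ≤ j < k`)**, `k ≥ 1`: lift the `k`-bud to the polynomial `𝒪`-algebra
`P = 𝒪[X_b : b ∈ B]` degree by degree, extend over `P ⊗ K` and descend to `P` (★ `exists_extend_of_injective` with
★ `exists_extend_of_units`), push down to `B`. [cite: Lazard1955, Thm. III] [cite: Drinfeld1974, §1 Prop. 1.4] -/
theorem budExt_of_budLift {k : ℕ} (hk : 1 ≤ k) (hlift : ∀ j, 1 ≤ j → j < k → BudLift.{u, w, max u w} 𝒪 j) :
    BudExt.{u, w} 𝒪 k := by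
  intro B _ _ f r h
  -- the polynomial ring `P ↠ B` and `P ↪ Q = K[X_b]`
  let P := MvPolynomial B 𝒪
  let π : P →ₐ[𝒪] B := MvPolynomial.aeval id
  have hπ : Function.Surjective π := fun b => ⟨MvPolynomial.X b, MvPolynomial.aeval_X _ b⟩
  let K := FractionRing 𝒪
  let Q := MvPolynomial B K
  let ι : P →ₐ[𝒪] Q := MvPolynomial.mapAlgHom (Algebra.ofId 𝒪 K)
  have hι : Function.Injective ι := fun x y hxy => by
    simp only [ι] at hxy
    exact MvPolynomial.map_injective _ (IsFractionRing.injective 𝒪 K) hxy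
  -- the units `ϖ^i − ϖ` in `Q`
  obtain ⟨ϖ, hϖ⟩ := IsDiscreteValuationRing.exists_irreducible 𝒪
  have hϖ𝔪 : ϖ ∈ IsLocalRing.maximalIdeal 𝒪 := (IsLocalRing.mem_maximalIdeal _).2 hϖ.not_isUnit
  have hunit : ∀ i : ℕ, 2 ≤ i → IsUnit (algebraMap 𝒪 Q ϖ ^ i - algebraMap 𝒪 Q ϖ) := by
    intro i hi
    have hne : ϖ ^ i - ϖ ≠ 0 := by
      have e : ϖ ^ i - ϖ = ϖ * (ϖ ^ (i - 1) - 1) := by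
        rw [mul_sub, mul_one, ← pow_succ', show i - 1 + 1 = i by omega]
      rw [e]
      refine mul_ne_zero hϖ.ne_zero (IsUnit.ne_zero ?_)
      have : ϖ ^ (i - 1) ∈ IsLocalRing.maximalIdeal 𝒪 := Ideal.pow_mem_of_mem _ hϖ𝔪 _ (by omega)
      rcases IsLocalRing.isUnit_or_isUnit_one_sub_self (ϖ ^ (i - 1)) with hu | hu
      · exact absurd hu (by simpa using this)
      · rw [← IsUnit.neg_iff, neg_sub]; exact hu
    have hK : IsUnit (algebraMap 𝒪 K (ϖ ^ i - ϖ)) :=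
      (IsUnit.mk0 _ ((map_ne_zero_iff _ (IsFractionRing.injective 𝒪 K)).2 hne))
    rw [← map_pow, ← map_sub, IsScalarTower.algebraMap_apply 𝒪 K Q]
    exact hK.map _
  -- lift `(f, r)` to a `k`-bud over `P`, degree by degree
  have hliftP : ∀ n : ℕ, ∃ (fP : MvPowerSeries (Fin 2) P) (rP : 𝒪 → PowerSeries P),
      IsOModuleBud 𝒪 (min (n + 1) k) fP rP ∧ ((min (n + 1) k + 1 : ℕ) : ℕ∞) ≤ (MvPowerSeries.map π.toRingHom fP - f).order ∧
      ∀ a, ((min (n + 1) k + 1 : ℕ) : ℕ∞) ≤ MvPowerSeries.order (PowerSeries.map π.toRingHom (rP a) - r a) := by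
    intro n
    induction n with
    | zero =>
      obtain ⟨h1, h2⟩ := additive_lies_over π h
      refine ⟨X 0 + X 1, fun a => algebraMap 𝒪 P a • PowerSeries.X, ?_, ?_, fun a => ?_⟩
      · rw [show min (0 + 1) k = 1 by omega]; exact isOModuleBud_additive 𝒪 P 1
      · rw [show min (0 + 1) k + 1 = 2 by omega]; exact h1
      · rw [show min (0 + 1) k + 1 = 2 by omega]; exact h2 a
    | succ n ih =>
      obtain ⟨fP, rP, hb, hf, hr⟩ := ih
      by_cases hlt : n + 1 < k
      · rw [min_eq_left hlt.le] at hb hf hr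
        rw [show min (n + 1 + 1) k = (n + 1) + 1 by omega]
        obtain ⟨F', ρ', h', -, -, hF', hρ'⟩ := hlift (n + 1) (by omega) hlt P B π hπ f r (h.mono (by omega)) fP rP hb hf hr
        exact ⟨F', ρ', h', hF', hρ'⟩
      · rw [show min (n + 1 + 1) k = min (n + 1) k by omega]
        exact ⟨fP, rP, hb, hf, hr⟩
  obtain ⟨fP, rP, hbP, hfP, hrP⟩ := hliftP k
  rw [min_eq_right (by omega)] at hbP hfP hrP
  -- extend over `P` by descent from `Q`
  obtain ⟨FP, ρP, hFP, hFf, hρr⟩ := IsOModuleBud.exists_extend_of_injective ι p hι hk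
    (fun f' r' h' => h'.exists_extend_of_units hk ϖ hunit) hbP
  -- push down to `B`
  refine ⟨MvPowerSeries.map π.toRingHom FP, fun a => PowerSeries.map π.toRingHom (ρP a), hFP.map π, ?_, fun a => ?_⟩
  · rw [show MvPowerSeries.map π.toRingHom FP - f = MvPowerSeries.map π.toRingHom (FP - fP) + (MvPowerSeries.map π.toRingHom fP - f)
      by rw [map_sub]; ring]
    exact natCast_le_order_add (hFf.trans (MvPowerSeries.le_order_map _)) hfP
  · rw [show PowerSeries.map π.toRingHom (ρP a) - r a = PowerSeries.map π.toRingHom (ρP a - rP a) +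
      (PowerSeries.map π.toRingHom (rP a) - r a) by rw [map_sub]; ring]
    refine natCast_le_order_add ((hρr a).trans ?_) (hrP a)
    exact MvPowerSeries.le_order_map (φ := ρP a - rP a) π.toRingHom

end Ext

/-! ## §4 The induction -/

include p in
/-- **Induction** (in the universe `max u w`, which is closed under `B ↦ 𝒪[X_b : b ∈ B]`): every `k`-bud extends, `k ≥ 1`.
[cite: Lazard1955, Thm. II–III] [cite: Drinfeld1974, §1 Prop. 1.4] -/
theorem budExt_max : ∀ k : ℕ, 1 ≤ k → BudExt.{u, max u w} 𝒪 k := by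
  intro k
  induction k using Nat.strong_induction_on with
  | _ k ih =>
    intro hk
    exact budExt_of_budLift.{u, max u w} p hk fun j hj hjk => budLift_of_budExt p hj (ih j hjk hj)

include p in
/-- **Every `k`-bud of formal `𝒪`-module laws extends to a `(k+1)`-bud** (`k ≥ 1`; `𝒪` a DVR with finite residue field of
characteristic `p`; any universe). [cite: Lazard1955, Thm. III] [cite: Drinfeld1974, §1 Prop. 1.4] -/
theorem budExt {k : ℕ} (hk : 1 ≤ k) : BudExt.{u, w} 𝒪 k :=
  budExt_of_budLift p hk fun j hj _ => budLift_of_budExt p hj (budExt_max.{u, w} p j hj)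

include p in
/-- **Buds lift along surjections** (`k ≥ 1`; any universes). [cite: Lazard1955, Thm. II–III] [cite: Drinfeld1974, §1 Prop. 1.4] -/
theorem budLift {k : ℕ} (hk : 1 ≤ k) : BudLift.{u, w, w'} 𝒪 k :=
  budLift_of_budExt p hk (budExt p hk)

end Literature.RingTheory.FormalGroups
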